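import Summits.HodgeConjecture.HodgeConjecture.Theorems.Ring2WeilCoverageCMFieldCyclicCofactorForms
import Summits.HodgeConjecture.HodgeConjecture.Theorems.Ring2WeilCoverageCMFieldCyclicPrimeRuleSqrtFiveB
import Summits.HodgeConjecture.HodgeConjecture.Theorems.Ring2WeilCoverageCMFieldCyclicPrimeRuleSqrtTwo
import Summits.HodgeConjecture.HodgeConjecture.Theorems.Ring2WeilCoverageCMFieldAllPrimesM
import HarnessLib

/-!
# Ring 2 — Weil-family coverage, CM-field rows: THE INTEGER ROWS `W8.E.[n]` of the three cyclic b03.29 tables —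
  `[n] = [1]` iff every non-split prime divides `n` to an even power; `[n₁] = [n₂]` iff equal parities
  (WEIL-FAMILY-COVERAGE «## b03», cell (xxi⁗), part 28)

research route conditional on HC_CM; not a corollary; Q11.4-sentence-2 already refuted in dim ≥ 3.

For the cyclic quartic CM fields `ℚ(√-(5+√5))` (`R = S² + 10S + 20`, conductor `40`), `ℚ(√-3(2+√2))`
(`S² + 12S + 18`, `48`), `ℚ(√-3(5+√5)/2)` (`S² + 15S + 45`, `60`) parts 24–26 classified the rational PRIMES.  Part IX-M's
generic `natCast_eq_split_iff_even` turns a prime classification into the classification of ALL integer rows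
`[n] ∈ F^×/Nm_{E/F}(E^×)` [cite: Deligne1982HodgeCycles, §4 p. 30, (1), Cor. 4.2], given the COFACTOR obstructions
`[ℓ·w] ≠ [1]` (`ℓ ∤ w`) of the non-split primes (part 27) and at most one exceptional prime:

* §69 `ℚ(√-(5+√5))`: cofactor obstruction for every non-split `ℓ ≠ 2` (inert `ℓ ≡ ±2 (5)` at `(ℓ)`; split at the
  degree-one place); exceptional prime `2`.  **`[n] = [1] ⟺` every prime `ℓ ∉ {5} ∪ H₄₀` divides `n` evenly.**
* §70 `ℚ(√-3(2+√2))`: exceptional prime `3`.  **`[n] = [1] ⟺` every prime `ℓ ∉ {2} ∪ H₄₈` divides `n` evenly.**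
* §71 `ℚ(√-3(5+√5)/2)`: exceptional prime `2`; the second special prime `3` (inert in `F`, ramified in `E`:
  `θ = 3·t`, `t = θ_{ℚ(ζ₅)}`) obstructs with a cofactor at the place `(3)` by part 27 (c) (`(3w, 3t)_{(3)} = -1`:
  `-w t` is a non-square in `𝔽₉` as `t⁴ ≡ -1`).  **`[n] = [1] ⟺` every prime `ℓ ∉ {5} ∪ H₆₀ divides `n` evenly.**
And `[n₁] = [n₂] ⟺` equal parities at the non-split primes: `n ↦ {non-split ℓ : ℓ ∥^odd n}` is a complete invariant of
the rational rows (as for the seven census tables, parts IX-M/N).  No new definition, no named fact, no sorry.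
-/

noncomputable section

set_option linter.dupNamespace false

open Polynomial NumberField IsDedekindDomain

namespace Summit.HodgeConjecture.HodgeConjecture.Ring2.WeilCoverageCM

open Literature.AlgebraicGeometry.Deligne1982
open Literature.AlgebraicGeometry.HodgeTheory (splitDiscriminantClassCM)
open Literature.NumberTheory.QuadraticForms

variable {R : Polynomial ℤ} [Fact (Irreducible (cmPolyQ R))] [Fact (Irreducible (realPolyQ R))]

/-! ### §69 `ℚ(√-(5+√5))` (conductor `40`): cofactor obstructions and the integer rows -/

section Cond40

/-- **Cofactor obstruction for `ℚ(√-(5+√5))`**: for every non-split prime `ℓ ≠ 2` (`ℓ ≠ 5`, `ℓ mod 40 ∉ H₄₀`) and every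
`w ∈ ℤ` with `ℓ ∤ w`: `[ℓ·w] ≠ [(-1)^k]` — inert `ℓ` at `(ℓ)` (part 27 (a)), split `ℓ` at the degree-one place with
`(2|ℓ)·ε₅(ℓ) = -1` (part 27 (b′)). [cite: Deligne1982HodgeCycles, §4 (1) and Cor. 4.2] [cite: Omeara1963, §63B Example 63:12] -/
theorem sqrtNegFivePlusSqrtFive_mk_natCast_mul_ne_splitDiscriminantClassCM (hR : R = X ^ 2 + C 10 * X + C 20)
    {ℓ : ℕ} (hℓ : ℓ.Prime) (hS : ¬ (ℓ = 5 ∨ (ℓ % 40 = 1 ∨ ℓ % 40 = 19 ∨ ℓ % 40 = 29 ∨ ℓ % 40 = 31))) (h2 : ℓ ≠ 2)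
    {w : ℤ} (hw : ¬ (ℓ : ℤ) ∣ w) (qℓ : (realField R)ˣ) (hqℓ : (qℓ : realField R) = (ℓ : realField R) * (w : realField R))
    (k : ℕ) : (QuotientGroup.mk qℓ : cmNormResidueGroup R) ≠ splitDiscriminantClassCM R k := by
  have h5 : ℓ ≠ 5 := fun h ↦ hS (Or.inl h)
  by_cases hin : ℓ % 5 = 2 ∨ ℓ % 5 = 3
  · haveI := Fact.mk hℓ
    have h5ns : ¬ IsSquare (5 : ZMod ℓ) := not_isSquare_five_of_mod_five h2 hin
    have h20 : (2 : ZMod ℓ) ≠ 0 := by exact_mod_cast natCast_prime_ne_zero_zmod Nat.prime_two h2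
    refine mk_natCast_mul_ne_splitDiscriminantClassCM_of_not_isSquare_disc_const hR hℓ h2 ?_ ?_ hw qℓ hqℓ k
    · have e : (((10 : ℤ) ^ 2 - 4 * 20 : ℤ) : ZMod ℓ) = 5 * 2 ^ 2 := by push_cast; norm_num
      rw [e, isSquare_mul_sq_iff_of_ne_zero h20]; exact h5ns
    · have e : (((20 : ℤ) : ℤ) : ZMod ℓ) = 5 * 2 ^ 2 := by push_cast; norm_num
      rw [e, isSquare_mul_sq_iff_of_ne_zero h20]; exact h5ns
  have h5' : ℓ % 5 ≠ 0 := fun h ↦ h5 ((Nat.prime_dvd_prime_iff_eq Nat.prime_five hℓ).1 (Nat.dvd_of_mod_eq_zero h)).symm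
  have hsp : ℓ % 5 = 1 ∨ ℓ % 5 = 4 := by omega
  have hsq5 : IsSquare ((ℓ : ℤ) : ZMod 5) := by
    have sq1 : IsSquare ((1 : ℕ) : ZMod 5) := by decide
    have sq4 : IsSquare ((4 : ℕ) : ZMod 5) := by decide
    rw [Int.cast_natCast, ← ZMod.natCast_mod ℓ 5]
    rcases hsp with h | h <;> rw [h]
    · exact sq1
    · exact sq4
  haveI := Fact.mk hℓ
  obtain ⟨hRm, -⟩ := monic_and_natDegree_of_quadratic R hR
  obtain ⟨θₒ, hθ⟩ := exists_ringOfIntegers_coe_eq_root hRm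
  have hroots := roots_real_neg_of_quadratic hR (by norm_num) (by norm_num) (by norm_num)
  have hdisc : ¬ (ℓ : ℤ) ∣ (10 : ℤ) ^ 2 - 4 * 20 := fun h ↦ by
    have h' : ℓ ∣ 2 ^ 2 * 3 ^ 0 * 5 ^ 1 := by norm_num at h ⊢; exact_mod_cast h
    rcases eq_of_prime_dvd_two_pow_mul hℓ h' with rfl | rfl | rfl <;> omega
  have hℓq : ¬ (ℓ : ℤ) ∣ (20 : ℤ) := fun h ↦ by
    have h' : ℓ ∣ 2 ^ 2 * 3 ^ 0 * 5 ^ 1 := by norm_num; exact_mod_cast h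
    rcases eq_of_prime_dvd_two_pow_mul hℓ h' with rfl | rfl | rfl <;> omega
  have h20 : (2 : ZMod ℓ) ≠ 0 := by exact_mod_cast natCast_prime_ne_zero_zmod Nat.prime_two h2
  have hdsq : IsSquare (((10 : ℤ) ^ 2 - 4 * 20 : ℤ) : ZMod ℓ) := by
    push_cast
    rw [show (20 : ZMod ℓ) = 5 * 2 ^ 2 by norm_num, isSquare_mul_sq_iff_of_ne_zero h20, isSquare_five_iff h2 h5]
    exact hsp
  have hℓ0 : (ℓ : realField R) ≠ 0 := by exact_mod_cast hℓ.ne_zero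
  have hchar : ∀ r : ZMod ℓ, r ^ 2 + ((10 : ℤ) : ZMod ℓ) * r + ((20 : ℤ) : ZMod ℓ) = 0 →
      (IsSquare r ↔ ((ℓ % 8 = 1 ∨ ℓ % 8 = 7) ↔ ℓ % 5 = 1)) :=
    fun r hr ↦ isSquare_root_iff_cond40 h2 h5 r (by push_cast at hr; exact hr)
  have hne := (sqrtNegFivePlusSqrtFive_mk_prime_ne_splitDiscriminantClassCM_iff_mod hR hℓ (Units.mk0 _ hℓ0)
    (Units.val_mk0 _) even_two).2 ⟨h5, fun h ↦ hS (Or.inr h)⟩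
  have hP := (mk_natCast_ne_splitDiscriminantClassCM_iff_of_root_character hR hroots hθ
    (sqrtNegFivePlusSqrtFive_ratPrimeRule_dyadic_unique hR) hℓ h2 hℓq hdisc hdsq
    (sqrtNegFivePlusSqrtFive_ratPrimeRule_root_places hR hθ hℓ h5 hsq5) hchar (Units.mk0 _ hℓ0) (Units.val_mk0 _)
    even_two).1 hne
  exact mk_natCast_mul_ne_splitDiscriminantClassCM_of_root_character hR hℓ h2 hℓq hdisc hdsq hchar hP hw qℓ hqℓ k

/-- **THE INTEGER ROWS of the `ℚ(√-(5+√5))` table**: for `n ≥ 1`, **`[n] = [1] ⟺` every prime `ℓ` with `ℓ ≠ 5` and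
`ℓ mod 40 ∉ {1, 19, 29, 31}` divides `n` to an EVEN power** (part IX-M on part 24's prime rule; exceptional prime `2`).
[cite: Deligne1982HodgeCycles, §4 (1) and Cor. 4.2] [cite: Landherr1936HermitianForms] -/
theorem sqrtNegFivePlusSqrtFive_natCast_eq_splitDiscriminantClassCM_iff (hR : R = X ^ 2 + C 10 * X + C 20) (n : ℕ)
    (hn : 1 ≤ n) (v : (realField R)ˣ) (hv : (v : realField R) = n) :
    (QuotientGroup.mk v : cmNormResidueGroup R) = splitDiscriminantClassCM R 2 ↔
      ∀ ℓ : ℕ, ℓ.Prime → ¬ (ℓ = 5 ∨ (ℓ % 40 = 1 ∨ ℓ % 40 = 19 ∨ ℓ % 40 = 29 ∨ ℓ % 40 = 31)) →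
        Even (n.factorization ℓ) := by
  refine natCast_eq_split_iff_even (fun ℓ ↦ ℓ = 5 ∨ (ℓ % 40 = 1 ∨ ℓ % 40 = 19 ∨ ℓ % 40 = 29 ∨ ℓ % 40 = 31)) 2
    ?_ ?_ ?_ n hn v hv
  · intro ℓ hℓ hs u hu
    exact (sqrtNegFivePlusSqrtFive_mk_prime_eq_splitDiscriminantClassCM_iff_mod hR hℓ u hu even_two).2 hs
  · intro _ _ u hu
    exact sqrtNegFivePlusSqrtFive_ratPrimeRule_mk_two_ne_splitDiscriminantClassCM hR u (by rw [hu]; norm_num) even_two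
  · intro ℓ hℓ hs h2 w hw u hu
    exact sqrtNegFivePlusSqrtFive_mk_natCast_mul_ne_splitDiscriminantClassCM hR hℓ hs h2 hw u
      (by rw [hu, map_mul, map_natCast, map_intCast]) 2

/-- **ROW STRUCTURE of the `ℚ(√-(5+√5))` table**: `[n₁] = [n₂] ⟺` equal parities at the primes `ℓ ≠ 5`, `ℓ mod 40 ∉ H₄₀`.
[cite: Deligne1982HodgeCycles, §4 (1) and Cor. 4.2] [cite: Landherr1936HermitianForms] -/
theorem sqrtNegFivePlusSqrtFive_natCast_mk_eq_mk_iff (hR : R = X ^ 2 + C 10 * X + C 20) {n₁ n₂ : ℕ} (hn₁ : 1 ≤ n₁)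
    (hn₂ : 1 ≤ n₂) (u v : (realField R)ˣ) (hu : (u : realField R) = n₁) (hv : (v : realField R) = n₂) :
    (QuotientGroup.mk u : cmNormResidueGroup R) = QuotientGroup.mk v ↔
      ∀ ℓ : ℕ, ℓ.Prime → ¬ (ℓ = 5 ∨ (ℓ % 40 = 1 ∨ ℓ % 40 = 19 ∨ ℓ % 40 = 29 ∨ ℓ % 40 = 31)) →
        (Even (n₁.factorization ℓ) ↔ Even (n₂.factorization ℓ)) := by
  refine natCast_mk_eq_mk_iff_even (fun ℓ ↦ ℓ = 5 ∨ (ℓ % 40 = 1 ∨ ℓ % 40 = 19 ∨ ℓ % 40 = 29 ∨ ℓ % 40 = 31)) 2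
    ?_ ?_ ?_ hn₁ hn₂ u v hu hv
  · intro ℓ hℓ hs u hu
    exact (sqrtNegFivePlusSqrtFive_mk_prime_eq_splitDiscriminantClassCM_iff_mod hR hℓ u hu even_two).2 hs
  · intro _ _ u hu
    exact sqrtNegFivePlusSqrtFive_ratPrimeRule_mk_two_ne_splitDiscriminantClassCM hR u (by rw [hu]; norm_num) even_two
  · intro ℓ hℓ hs h2 w hw u hu
    exact sqrtNegFivePlusSqrtFive_mk_natCast_mul_ne_splitDiscriminantClassCM hR hℓ hs h2 hw u
      (by rw [hu, map_mul, map_natCast, map_intCast]) 2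

end Cond40

/-! ### §70 `ℚ(√-3(2+√2))` (conductor `48`): cofactor obstructions and the integer rows -/

section Cond48

/-- **Cofactor obstruction for `ℚ(√-3(2+√2))`**: for every non-split prime `ℓ ≠ 3` and every `w` with `ℓ ∤ w`:
`[ℓ·w] ≠ [(-1)^k]` (inert `ℓ ≡ ±3 (mod 8)` at `(ℓ)`; split via `(-3|ℓ)·ε₁₆(ℓ) = -1`). [cite: Deligne1982HodgeCycles, §4 (1) and Cor. 4.2] -/
theorem sqrtNegThreeTimesTwoPlusSqrtTwo_mk_natCast_mul_ne_splitDiscriminantClassCM (hR : R = X ^ 2 + C 12 * X + C 18)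
    {ℓ : ℕ} (hℓ : ℓ.Prime) (hS : ¬ (ℓ = 2 ∨ (ℓ % 48 = 1 ∨ ℓ % 48 = 23 ∨ ℓ % 48 = 31 ∨ ℓ % 48 = 41))) (h3 : ℓ ≠ 3)
    {w : ℤ} (hw : ¬ (ℓ : ℤ) ∣ w) (qℓ : (realField R)ˣ) (hqℓ : (qℓ : realField R) = (ℓ : realField R) * (w : realField R))
    (k : ℕ) : (QuotientGroup.mk qℓ : cmNormResidueGroup R) ≠ splitDiscriminantClassCM R k := by
  have h2 : ℓ ≠ 2 := fun h ↦ hS (Or.inl h)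
  haveI := Fact.mk hℓ
  have h20 : (2 : ZMod ℓ) ≠ 0 := by exact_mod_cast natCast_prime_ne_zero_zmod Nat.prime_two h2
  have h30 : (3 : ZMod ℓ) ≠ 0 := by exact_mod_cast natCast_prime_ne_zero_zmod Nat.prime_three h3
  have h60 : (6 : ZMod ℓ) ≠ 0 := by rw [show (6 : ZMod ℓ) = 2 * 3 by norm_num]; exact mul_ne_zero h20 h30
  by_cases hin : ℓ % 8 = 3 ∨ ℓ % 8 = 5
  · have hn2 : ¬ IsSquare (2 : ZMod ℓ) := by rw [ZMod.exists_sq_eq_two_iff h2]; omega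
    refine mk_natCast_mul_ne_splitDiscriminantClassCM_of_not_isSquare_disc_const hR hℓ h2 ?_ ?_ hw qℓ hqℓ k
    · have e : (((12 : ℤ) ^ 2 - 4 * 18 : ℤ) : ZMod ℓ) = 2 * 6 ^ 2 := by push_cast; norm_num
      rw [e, isSquare_mul_sq_iff_of_ne_zero h60]; exact hn2
    · have e : (((18 : ℤ) : ℤ) : ZMod ℓ) = 2 * 3 ^ 2 := by push_cast; norm_num
      rw [e, isSquare_mul_sq_iff_of_ne_zero h30]; exact hn2
  have hodd : ℓ % 2 = 1 := (Nat.Prime.mod_two_eq_one_iff_ne_two hℓ).2 h2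
  have hsp : ℓ % 8 = 1 ∨ ℓ % 8 = 7 := by omega
  obtain ⟨hRm, -⟩ := monic_and_natDegree_of_quadratic R hR
  obtain ⟨θₒ, hθ⟩ := exists_ringOfIntegers_coe_eq_root hRm
  have hroots := roots_real_neg_of_quadratic hR (by norm_num) (by norm_num) (by norm_num)
  have hdisc : ¬ (ℓ : ℤ) ∣ (12 : ℤ) ^ 2 - 4 * 18 := fun h ↦ by
    have h' : ℓ ∣ 2 ^ 3 * 3 ^ 2 * 5 ^ 0 := by norm_num at h ⊢; exact_mod_cast h
    rcases eq_of_prime_dvd_two_pow_mul hℓ h' with rfl | rfl | rfl <;> omega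
  have hℓq : ¬ (ℓ : ℤ) ∣ (18 : ℤ) := fun h ↦ by
    have h' : ℓ ∣ 2 ^ 1 * 3 ^ 2 * 5 ^ 0 := by norm_num; exact_mod_cast h
    rcases eq_of_prime_dvd_two_pow_mul hℓ h' with rfl | rfl | rfl <;> omega
  have hdsq : IsSquare (((12 : ℤ) ^ 2 - 4 * 18 : ℤ) : ZMod ℓ) := by
    push_cast
    rw [show (72 : ZMod ℓ) = 2 * 6 ^ 2 by norm_num, isSquare_mul_sq_iff_of_ne_zero h60, ZMod.exists_sq_eq_two_iff h2]
    exact hsp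
  have hℓ0 : (ℓ : realField R) ≠ 0 := by exact_mod_cast hℓ.ne_zero
  have hchar : ∀ r : ZMod ℓ, r ^ 2 + ((12 : ℤ) : ZMod ℓ) * r + ((18 : ℤ) : ZMod ℓ) = 0 →
      (IsSquare r ↔ (ℓ % 3 = 1 ↔ (ℓ % 16 = 1 ∨ ℓ % 16 = 15))) :=
    fun r hr ↦ isSquare_root_iff_cond48 h2 h3 r (by push_cast at hr; exact hr)
  have hne := (sqrtNegThreeTimesTwoPlusSqrtTwo_mk_prime_ne_splitDiscriminantClassCM_iff_mod hR hℓ (Units.mk0 _ hℓ0)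
    (Units.val_mk0 _) even_two).2 ⟨h2, fun h ↦ hS (Or.inr h)⟩
  have hP := (mk_natCast_ne_splitDiscriminantClassCM_iff_of_root_character hR hroots hθ
    (sqrtNegThreeTimesTwoPlusSqrtTwo_ratPrimeRule_dyadic_unique hR) hℓ h2 hℓq hdisc hdsq
    (sqrtNegThreeTimesTwoPlusSqrtTwo_ratPrimeRule_root_places hR hθ hℓ h3) hchar (Units.mk0 _ hℓ0) (Units.val_mk0 _)
    even_two).1 hne
  exact mk_natCast_mul_ne_splitDiscriminantClassCM_of_root_character hR hℓ h2 hℓq hdisc hdsq hchar hP hw qℓ hqℓ k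

/-- **THE INTEGER ROWS of the `ℚ(√-3(2+√2))` table**: for `n ≥ 1`, **`[n] = [1] ⟺` every prime `ℓ ≠ 2` with
`ℓ mod 48 ∉ {1, 23, 31, 41}` divides `n` to an EVEN power**. [cite: Deligne1982HodgeCycles, §4 (1) and Cor. 4.2] -/
theorem sqrtNegThreeTimesTwoPlusSqrtTwo_natCast_eq_splitDiscriminantClassCM_iff (hR : R = X ^ 2 + C 12 * X + C 18) (n : ℕ)
    (hn : 1 ≤ n) (v : (realField R)ˣ) (hv : (v : realField R) = n) :
    (QuotientGroup.mk v : cmNormResidueGroup R) = splitDiscriminantClassCM R 2 ↔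
      ∀ ℓ : ℕ, ℓ.Prime → ¬ (ℓ = 2 ∨ (ℓ % 48 = 1 ∨ ℓ % 48 = 23 ∨ ℓ % 48 = 31 ∨ ℓ % 48 = 41)) →
        Even (n.factorization ℓ) := by
  refine natCast_eq_split_iff_even (fun ℓ ↦ ℓ = 2 ∨ (ℓ % 48 = 1 ∨ ℓ % 48 = 23 ∨ ℓ % 48 = 31 ∨ ℓ % 48 = 41)) 3
    ?_ ?_ ?_ n hn v hv
  · intro ℓ hℓ hs u hu
    exact (sqrtNegThreeTimesTwoPlusSqrtTwo_mk_prime_eq_splitDiscriminantClassCM_iff_mod hR hℓ u hu even_two).2 hs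
  · intro _ _ u hu
    exact sqrtNegThreeTimesTwoPlusSqrtTwo_ratPrimeRule_mk_three_ne_splitDiscriminantClassCM hR u (by rw [hu]; norm_num)
      even_two
  · intro ℓ hℓ hs h3 w hw u hu
    exact sqrtNegThreeTimesTwoPlusSqrtTwo_mk_natCast_mul_ne_splitDiscriminantClassCM hR hℓ hs h3 hw u
      (by rw [hu, map_mul, map_natCast, map_intCast]) 2

/-- **ROW STRUCTURE of the `ℚ(√-3(2+√2))` table**: `[n₁] = [n₂] ⟺` equal parities at the primes `ℓ ≠ 2`, `ℓ mod 48 ∉ H₄₈`.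
[cite: Deligne1982HodgeCycles, §4 (1) and Cor. 4.2] [cite: Landherr1936HermitianForms] -/
theorem sqrtNegThreeTimesTwoPlusSqrtTwo_natCast_mk_eq_mk_iff (hR : R = X ^ 2 + C 12 * X + C 18) {n₁ n₂ : ℕ}
    (hn₁ : 1 ≤ n₁) (hn₂ : 1 ≤ n₂) (u v : (realField R)ˣ) (hu : (u : realField R) = n₁) (hv : (v : realField R) = n₂) :
    (QuotientGroup.mk u : cmNormResidueGroup R) = QuotientGroup.mk v ↔
      ∀ ℓ : ℕ, ℓ.Prime → ¬ (ℓ = 2 ∨ (ℓ % 48 = 1 ∨ ℓ % 48 = 23 ∨ ℓ % 48 = 31 ∨ ℓ % 48 = 41)) →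
        (Even (n₁.factorization ℓ) ↔ Even (n₂.factorization ℓ)) := by
  refine natCast_mk_eq_mk_iff_even (fun ℓ ↦ ℓ = 2 ∨ (ℓ % 48 = 1 ∨ ℓ % 48 = 23 ∨ ℓ % 48 = 31 ∨ ℓ % 48 = 41)) 3
    ?_ ?_ ?_ hn₁ hn₂ u v hu hv
  · intro ℓ hℓ hs u hu
    exact (sqrtNegThreeTimesTwoPlusSqrtTwo_mk_prime_eq_splitDiscriminantClassCM_iff_mod hR hℓ u hu even_two).2 hs
  · intro _ _ u hu
    exact sqrtNegThreeTimesTwoPlusSqrtTwo_ratPrimeRule_mk_three_ne_splitDiscriminantClassCM hR u (by rw [hu]; norm_num)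
      even_two
  · intro ℓ hℓ hs h3 w hw u hu
    exact sqrtNegThreeTimesTwoPlusSqrtTwo_mk_natCast_mul_ne_splitDiscriminantClassCM hR hℓ hs h3 hw u
      (by rw [hu, map_mul, map_natCast, map_intCast]) 2

end Cond48

/-! ### §71 `ℚ(√-3(5+√5)/2)` (conductor `60`): the second special prime `3` with a cofactor, and the integer rows -/

section Cond60

omit [Fact (Irreducible (cmPolyQ R))] in
/-- `t = θ/3 = (-5 ∓ √5)/2 ∈ 𝓞_F` (a root of `S² + 5S + 5`: `E = F(√θ)` is the twist of `ℚ(ζ₅) = F(√t)` by `√3`). [folklore] -/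
theorem sqrtNegThreeTimesFivePlusSqrtFiveHalf_ratPrimeRule_exists_third (hR : R = X ^ 2 + C 15 * X + C 45) :
    ∃ t : 𝓞 (realField R), (t : realField R) = AdjoinRoot.root (realPolyQ R) / 3 ∧ t ^ 2 + 5 * t + 5 = 0 := by
  have hrel := root_rel_quadratic hR
  push_cast at hrel
  have hsq : (AdjoinRoot.root (realPolyQ R) / 3) ^ 2 + 5 * (AdjoinRoot.root (realPolyQ R) / 3) + 5 = (0 : realField R) := by
    linear_combination (1 / 9 : realField R) * hrel
  have hint : IsIntegral ℤ (AdjoinRoot.root (realPolyQ R) / 3 : realField R) := by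
    refine ⟨X ^ 2 + C 5 * X + C 5, by monicity!, ?_⟩
    rw [eval₂_add, eval₂_add, eval₂_X_pow, eval₂_mul, eval₂_C, eval₂_X, eq_intCast]
    push_cast
    linear_combination hsq
  refine ⟨⟨_, hint⟩, rfl, ?_⟩
  refine RingOfIntegers.ext ?_
  simp only [map_add, map_mul, map_pow, map_ofNat, map_zero]
  exact hsq

/-- **`[3·w] ≠ [1]` for `ℚ(√-3(5+√5)/2)` and every `w ∈ ℤ` with `3 ∤ w`** (`k` even), at the place `v = (3)` (inert in
`F = ℚ(√5)`, `N v = 9`): `θ = 3·t`, `t ∉ v`, `-t` a NON-square mod `v` (`t⁴ + 1 = -3(25t + 33)`, Euler), `w` a `v`-unit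
square (an integer in `𝔽₉`), so `(3w, θ)_v = -1` by part 27 (c). [cite: Deligne1982HodgeCycles, §4 (1) and Cor. 4.2]
[cite: Omeara1963, §63 Example 63:12] -/
theorem sqrtNegThreeTimesFivePlusSqrtFiveHalf_ratPrimeRule_mk_three_mul_ne_splitDiscriminantClassCM
    (hR : R = X ^ 2 + C 15 * X + C 45) {w : ℤ} (hw : ¬ (3 : ℤ) ∣ w) (qℓ : (realField R)ˣ)
    (hqℓ : (qℓ : realField R) = (3 : realField R) * (w : realField R)) {k : ℕ} (hk : Even k) :
    (QuotientGroup.mk qℓ : cmNormResidueGroup R) ≠ splitDiscriminantClassCM R k := by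
  have hK := finrank_realField_quadratic hR
  have hnsq : ¬ IsSquare (((5 : ℤ) : ℤ) : ZMod 3) := by decide
  obtain ⟨hRm, -⟩ := monic_and_natDegree_of_quadratic R hR
  obtain ⟨θₒ, hθ⟩ := exists_ringOfIntegers_coe_eq_root hRm
  obtain ⟨s, -, hs⟩ := sqrtNegThreeTimesFivePlusSqrtFiveHalf_ratPrimeRule_exists_sq_eq_five hR
  have hs' : s ^ 2 = ((5 : ℤ) : 𝓞 (realField R)) := by rw [hs]; norm_num
  obtain ⟨t, ht, ht2⟩ := sqrtNegThreeTimesFivePlusSqrtFiveHalf_ratPrimeRule_exists_third hR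
  have hθt : θₒ = ((3 : ℕ) : 𝓞 (realField R)) * t := by
    refine RingOfIntegers.ext ?_
    simp only [map_mul, map_natCast]
    rw [show (algebraMap (𝓞 (realField R)) (realField R)) t = (t : realField R) from rfl, ht, hθ]
    push_cast
    field_simp
  -- the place `v = (3)`: `N v = 9`, uniformiser `3`
  obtain ⟨v, h3v⟩ := exists_place_natCast_mem hK Nat.prime_three
  have hN : Ideal.absNorm v.asIdeal = 3 ^ 2 := absNorm_eq_sq_of_inert_radicand hK hs' Nat.prime_three hnsq v h3v
  have h3v' : ((3 : ℤ) : 𝓞 (realField R)) ∈ v.asIdeal := by exact_mod_cast h3v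
  have h2v : (2 : 𝓞 (realField R)) ∉ v.asIdeal := by
    have := intCast_notMem_of_isCoprime v (show IsCoprime (3 : ℤ) 2 by norm_num) h3v'
    exact_mod_cast this
  have hv3 : v.asIdeal = Ideal.span {((3 : ℕ) : 𝓞 (realField R))} :=
    (ideal_eq_of_le_of_absNorm_eq ((Ideal.span_singleton_le_iff_mem _).2 h3v) (by rw [hN]; norm_num)
      (by rw [absNorm_span_natCast, hK, hN])).symm
  have hπ : v.intValuation ((3 : ℕ) : 𝓞 (realField R)) = WithZero.exp (-1 : ℤ) :=
    HeightOneSpectrum.intValuation_singleton (v := v) (by norm_num) hv3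
  -- `t ∉ v`, `-t` non-square mod `v`
  have htv : t ∉ v.asIdeal := fun h ↦ by
    have h5 : ((5 : ℤ) : 𝓞 (realField R)) ∈ v.asIdeal := by
      have e : ((5 : ℤ) : 𝓞 (realField R)) = -(t * (t + 5)) + (t ^ 2 + 5 * t + 5) := by push_cast; ring
      rw [e, ht2, add_zero]
      exact v.asIdeal.neg_mem (v.asIdeal.mul_mem_right _ h)
    exact intCast_notMem_of_isCoprime v (show IsCoprime (3 : ℤ) 5 by norm_num) h3v' h5
  have hns : ¬ IsSquare (Ideal.Quotient.mk v.asIdeal (-t)) := by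
    refine not_isSquare_residue_of_pow_add_one_mem v h2v (n := 4) (by rw [hN]; norm_num) ?_
    have e : (-t) ^ 4 + 1 = ((3 : ℕ) : 𝓞 (realField R)) * (-(25 * t + 33)) := by
      push_cast; linear_combination (t ^ 2 - 5 * t + 20) * ht2
    rw [e]; exact v.asIdeal.mul_mem_right _ h3v
  -- the cofactor `w`: a `v`-unit, a square in `𝔽₉`
  have hwv : (w : 𝓞 (realField R)) ∉ v.asIdeal :=
    intCast_notMem_of_isCoprime v ((Prime.coprime_iff_not_dvd (Int.prime_three)).2 hw) h3v'
  have hwsq : IsSquare (Ideal.Quotient.mk v.asIdeal (w : 𝓞 (realField R))) :=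
    isSquare_intCast_residue_of_absNorm_eq_sq v Nat.prime_three hN w
  refine mk_ne_splitDiscriminantClassCM_of_uniformizer_mul hθ v h2v hπ hθt htv hns hwv hwsq qℓ ?_ hk
  rw [hqℓ, show ((((3 : ℕ) : 𝓞 (realField R)) * (w : 𝓞 (realField R)) : 𝓞 (realField R)) : realField R) =
    algebraMap (𝓞 (realField R)) (realField R) (((3 : ℕ) : 𝓞 (realField R)) * (w : 𝓞 (realField R))) from rfl,
    map_mul, map_natCast, map_intCast]
  norm_num

/-- **Cofactor obstruction for `ℚ(√-3(5+√5)/2)`**: for every non-split prime `ℓ ≠ 2` and every `w` with `ℓ ∤ w`: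
`[ℓ·w] ≠ [1]` (`ℓ = 3` at `(3)`; inert `ℓ` at `(ℓ)`; split via `(3|ℓ)·ε₅(ℓ) = -1`). [cite: Deligne1982HodgeCycles, §4 (1) and Cor. 4.2] -/
theorem sqrtNegThreeTimesFivePlusSqrtFiveHalf_mk_natCast_mul_ne_splitDiscriminantClassCM (hR : R = X ^ 2 + C 15 * X + C 45)
    {ℓ : ℕ} (hℓ : ℓ.Prime) (hS : ¬ (ℓ = 5 ∨ (ℓ % 60 = 1 ∨ ℓ % 60 = 11 ∨ ℓ % 60 = 19 ∨ ℓ % 60 = 29))) (h2 : ℓ ≠ 2)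
    {w : ℤ} (hw : ¬ (ℓ : ℤ) ∣ w) (qℓ : (realField R)ˣ) (hqℓ : (qℓ : realField R) = (ℓ : realField R) * (w : realField R)) :
    (QuotientGroup.mk qℓ : cmNormResidueGroup R) ≠ splitDiscriminantClassCM R 2 := by
  have h5 : ℓ ≠ 5 := fun h ↦ hS (Or.inl h)
  by_cases h3 : ℓ = 3
  · subst h3
    exact sqrtNegThreeTimesFivePlusSqrtFiveHalf_ratPrimeRule_mk_three_mul_ne_splitDiscriminantClassCM hR
      (by exact_mod_cast hw) qℓ (by rw [hqℓ]; norm_num) even_two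
  by_cases hin : ℓ % 5 = 2 ∨ ℓ % 5 = 3
  · haveI := Fact.mk hℓ
    have h5ns : ¬ IsSquare (5 : ZMod ℓ) := not_isSquare_five_of_mod_five h2 hin
    have h30 : (3 : ZMod ℓ) ≠ 0 := by exact_mod_cast natCast_prime_ne_zero_zmod Nat.prime_three h3
    refine mk_natCast_mul_ne_splitDiscriminantClassCM_of_not_isSquare_disc_const hR hℓ h2 ?_ ?_ hw qℓ hqℓ 2
    · have e : (((15 : ℤ) ^ 2 - 4 * 45 : ℤ) : ZMod ℓ) = 5 * 3 ^ 2 := by push_cast; norm_num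
      rw [e, isSquare_mul_sq_iff_of_ne_zero h30]; exact h5ns
    · have e : (((45 : ℤ) : ℤ) : ZMod ℓ) = 5 * 3 ^ 2 := by push_cast; norm_num
      rw [e, isSquare_mul_sq_iff_of_ne_zero h30]; exact h5ns
  have h5' : ℓ % 5 ≠ 0 := fun h ↦ h5 ((Nat.prime_dvd_prime_iff_eq Nat.prime_five hℓ).1 (Nat.dvd_of_mod_eq_zero h)).symm
  have hsp : ℓ % 5 = 1 ∨ ℓ % 5 = 4 := by omega
  have hsq5 : IsSquare ((ℓ : ℤ) : ZMod 5) := by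
    have sq1 : IsSquare ((1 : ℕ) : ZMod 5) := by decide
    have sq4 : IsSquare ((4 : ℕ) : ZMod 5) := by decide
    rw [Int.cast_natCast, ← ZMod.natCast_mod ℓ 5]
    rcases hsp with h | h <;> rw [h]
    · exact sq1
    · exact sq4
  haveI := Fact.mk hℓ
  obtain ⟨hRm, -⟩ := monic_and_natDegree_of_quadratic R hR
  obtain ⟨θₒ, hθ⟩ := exists_ringOfIntegers_coe_eq_root hRm
  have hroots := roots_real_neg_of_quadratic hR (by norm_num) (by norm_num) (by norm_num)
  have hdisc : ¬ (ℓ : ℤ) ∣ (15 : ℤ) ^ 2 - 4 * 45 := fun h ↦ by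
    have h' : ℓ ∣ 2 ^ 0 * 3 ^ 2 * 5 ^ 1 := by norm_num at h ⊢; exact_mod_cast h
    rcases eq_of_prime_dvd_two_pow_mul hℓ h' with rfl | rfl | rfl <;> omega
  have hℓq : ¬ (ℓ : ℤ) ∣ (45 : ℤ) := fun h ↦ by
    have h' : ℓ ∣ 2 ^ 0 * 3 ^ 2 * 5 ^ 1 := by norm_num; exact_mod_cast h
    rcases eq_of_prime_dvd_two_pow_mul hℓ h' with rfl | rfl | rfl <;> omega
  have h30 : (3 : ZMod ℓ) ≠ 0 := by exact_mod_cast natCast_prime_ne_zero_zmod Nat.prime_three h3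
  have hdsq : IsSquare (((15 : ℤ) ^ 2 - 4 * 45 : ℤ) : ZMod ℓ) := by
    push_cast
    rw [show (45 : ZMod ℓ) = 5 * 3 ^ 2 by norm_num, isSquare_mul_sq_iff_of_ne_zero h30, isSquare_five_iff h2 h5]
    exact hsp
  have hℓ0 : (ℓ : realField R) ≠ 0 := by exact_mod_cast hℓ.ne_zero
  have hchar : ∀ r : ZMod ℓ, r ^ 2 + ((15 : ℤ) : ZMod ℓ) * r + ((45 : ℤ) : ZMod ℓ) = 0 →
      (IsSquare r ↔ ((ℓ % 12 = 1 ∨ ℓ % 12 = 11) ↔ ℓ % 5 = 1)) :=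
    fun r hr ↦ isSquare_root_iff_cond60 h2 h3 h5 r (by push_cast at hr; exact hr)
  have hne := (sqrtNegThreeTimesFivePlusSqrtFiveHalf_mk_prime_ne_splitDiscriminantClassCM_iff_mod hR hℓ (Units.mk0 _ hℓ0)
    (Units.val_mk0 _) even_two).2 ⟨h5, fun h ↦ hS (Or.inr h)⟩
  have hP := (mk_natCast_ne_splitDiscriminantClassCM_iff_of_root_character hR hroots hθ
    (sqrtNegThreeTimesFivePlusSqrtFiveHalf_ratPrimeRule_dyadic_unique hR) hℓ h2 hℓq hdisc hdsq
    (sqrtNegThreeTimesFivePlusSqrtFiveHalf_ratPrimeRule_root_places hR hθ hℓ h3 h5 hsq5) hchar (Units.mk0 _ hℓ0)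
    (Units.val_mk0 _) even_two).1 hne
  exact mk_natCast_mul_ne_splitDiscriminantClassCM_of_root_character hR hℓ h2 hℓq hdisc hdsq hchar hP hw qℓ hqℓ 2

/-- **THE INTEGER ROWS of the `ℚ(√-3(5+√5)/2)` table**: for `n ≥ 1`, **`[n] = [1] ⟺` every prime `ℓ ≠ 5` with
`ℓ mod 60 ∉ {1, 11, 19, 29}` divides `n` to an EVEN power**. [cite: Deligne1982HodgeCycles, §4 (1) and Cor. 4.2] -/
theorem sqrtNegThreeTimesFivePlusSqrtFiveHalf_natCast_eq_splitDiscriminantClassCM_iff (hR : R = X ^ 2 + C 15 * X + C 45)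
    (n : ℕ) (hn : 1 ≤ n) (v : (realField R)ˣ) (hv : (v : realField R) = n) :
    (QuotientGroup.mk v : cmNormResidueGroup R) = splitDiscriminantClassCM R 2 ↔
      ∀ ℓ : ℕ, ℓ.Prime → ¬ (ℓ = 5 ∨ (ℓ % 60 = 1 ∨ ℓ % 60 = 11 ∨ ℓ % 60 = 19 ∨ ℓ % 60 = 29)) →
        Even (n.factorization ℓ) := by
  refine natCast_eq_split_iff_even (fun ℓ ↦ ℓ = 5 ∨ (ℓ % 60 = 1 ∨ ℓ % 60 = 11 ∨ ℓ % 60 = 19 ∨ ℓ % 60 = 29)) 2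
    ?_ ?_ ?_ n hn v hv
  · intro ℓ hℓ hs u hu
    exact (sqrtNegThreeTimesFivePlusSqrtFiveHalf_mk_prime_eq_splitDiscriminantClassCM_iff_mod hR hℓ u hu even_two).2 hs
  · intro _ _ u hu
    exact sqrtNegThreeTimesFivePlusSqrtFiveHalf_ratPrimeRule_mk_ne_splitDiscriminantClassCM_of_dvd_six hR (Or.inl rfl) u
      (by rw [hu]) even_two
  · intro ℓ hℓ hs h2 w hw u hu
    exact sqrtNegThreeTimesFivePlusSqrtFiveHalf_mk_natCast_mul_ne_splitDiscriminantClassCM hR hℓ hs h2 hw u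
      (by rw [hu, map_mul, map_natCast, map_intCast])

/-- **ROW STRUCTURE of the `ℚ(√-3(5+√5)/2)` table**: `[n₁] = [n₂] ⟺` equal parities at the primes `ℓ ≠ 5`, `ℓ mod 60 ∉ H₆₀`.
[cite: Deligne1982HodgeCycles, §4 (1) and Cor. 4.2] [cite: Landherr1936HermitianForms] -/
theorem sqrtNegThreeTimesFivePlusSqrtFiveHalf_natCast_mk_eq_mk_iff (hR : R = X ^ 2 + C 15 * X + C 45) {n₁ n₂ : ℕ}
    (hn₁ : 1 ≤ n₁) (hn₂ : 1 ≤ n₂) (u v : (realField R)ˣ) (hu : (u : realField R) = n₁) (hv : (v : realField R) = n₂) :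
    (QuotientGroup.mk u : cmNormResidueGroup R) = QuotientGroup.mk v ↔
      ∀ ℓ : ℕ, ℓ.Prime → ¬ (ℓ = 5 ∨ (ℓ % 60 = 1 ∨ ℓ % 60 = 11 ∨ ℓ % 60 = 19 ∨ ℓ % 60 = 29)) →
        (Even (n₁.factorization ℓ) ↔ Even (n₂.factorization ℓ)) := by
  refine natCast_mk_eq_mk_iff_even (fun ℓ ↦ ℓ = 5 ∨ (ℓ % 60 = 1 ∨ ℓ % 60 = 11 ∨ ℓ % 60 = 19 ∨ ℓ % 60 = 29)) 2
    ?_ ?_ ?_ hn₁ hn₂ u v hu hv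
  · intro ℓ hℓ hs u hu
    exact (sqrtNegThreeTimesFivePlusSqrtFiveHalf_mk_prime_eq_splitDiscriminantClassCM_iff_mod hR hℓ u hu even_two).2 hs
  · intro _ _ u hu
    exact sqrtNegThreeTimesFivePlusSqrtFiveHalf_ratPrimeRule_mk_ne_splitDiscriminantClassCM_of_dvd_six hR (Or.inl rfl) u
      (by rw [hu]) even_two
  · intro ℓ hℓ hs h2 w hw u hu
    exact sqrtNegThreeTimesFivePlusSqrtFiveHalf_mk_natCast_mul_ne_splitDiscriminantClassCM hR hℓ hs h2 hw u
      (by rw [hu, map_mul, map_natCast, map_intCast])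

end Cond60

end Summit.HodgeConjecture.HodgeConjecture.Ring2.WeilCoverageCM

end
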